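import Summits.HodgeConjecture.HodgeConjecture.Theorems.F0P3UnitaryLocOfRecord               -- ★ `IsCohUnitaryClass`, `Cinf`
import Summits.HodgeConjecture.HodgeConjecture.Theorems.F0P3XiArchPacketOfRecord              -- ★ `JInfNoDegOne`, `DsInfNoDegOne`
import Summits.HodgeConjecture.HodgeConjecture.Theorems.F0P3bStubT3aUnitaryAlongPOfHermitian  -- ★ `stubT3aUnitaryAlongPOfHermitian_holds`
import Literature.RepresentationTheory.BorelWallach2000.TrivialModuleGKCohomologyUnitary     -- ★ `upq_subsingleton_gkCohomology_triv_of_odd`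
import Literature.RepresentationTheory.BorelWallach2000.UpqTypeFunctoriality               -- ★ `GKEquiv.comm𝔤`, `GKEquiv.commK`
import Literature.NumberTheory.Automorphic.GKCohomologyFunctorIso                           -- ★ `subsingleton_gkCohomology_iff_of_equiv`
import Literature.NumberTheory.Automorphic.GKModulesAdmissible                              -- ★ `isAdmissibleGK_of_finiteDimensional`
import Mathlib.Analysis.InnerProductSpace.Basic
import HarnessLib

/-!
# Rung-0 junction, clauses R3∕R4: the archimedean-class clauses of `Rung0Witness` admit LETTER-FREE witnesses

Summit `HodgeConjecture`, crux H413 (`stmt-HodgeConjecture-24833`), closer line `Cruxes/H413/Lines/F0_U3LettersRung1.lean` (ED. 10),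
§B `Rung0Witness`: the fields `c`, `jInf`, `dsInf` and their clauses `hc : c = 1 ∨ c = -1`, `hJ : JInfNoDegOne jInf`, `hD : DsInfNoDegOne dsInf`,
`hJU : ∀ p q t, IsCohUnitaryClass (jInf p q t)`, `hDU : ∀ p q t, IsCohUnitaryClass (dsInf p q t)` (R3∕R4 of the Stage-D read, F0P3-plan (g7) «D»
2026-08-31T20:34:18Z: «junk witnesses if the types admit them (preferred, no letters), else two more named stubs»).

THIS FILE: the types DO admit witnesses, kernel-checked, with NO letter.  The witness class is the class `𝟙 ∈ Cinf` of the TRIVIAL one-dimensional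
`(𝔲(2,1), K)`-module `(ℂ, trivK = 1, trivLie = 0)` (★ `GKTrivialTensor.trivK ∕ trivLie`):
* §1 it is a `(𝔤, K)`-module (`isGKModule_triv`), irreducible (`isIrreducibleGK_triv`), admissible (★ `isAdmissibleGK_of_finiteDimensional`) and unitary
  along `𝔭 ⊕ ℝz₀` (★ `stubT3aUnitaryAlongPOfHermitian_holds` with `H = ⟪·,·⟫_ℂ`), hence coh-unitary (`isCohUnitaryIrrep_triv`) and its class is an
  ★ `IsCohUnitaryClass` (`isCohUnitaryClass_ofModule_triv`);
* §2 `H^q(𝔲(2,1), K; 𝟙) = 0` for odd `q` (★ `upq_subsingleton_gkCohomology_triv_of_odd`, [BorelWallach2000, I §5.1, VI Thm. 4.11 (3)]: the row of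
  `J_{0,0}` is `ℂ` in degrees `0, 2, 4` only) transported along `(𝔤, K)`-equivalences (★ `subsingleton_gkCohomology_iff_of_equiv`) to EVERY irreducible
  module of that class, so every `upqTypeClasses … q δ`, `q` odd, is `⊥` there (`upqTypeClasses_eq_bot_of_ofModule_eq_triv`);
* §3 the clauses: `JInfNoDegOne (fun _ _ _ => 𝟙)`, `DsInfNoDegOne (fun _ _ _ => 𝟙)`, coh-unitarity, and the packaged `∃ c jInf dsInf, …` with `c = 1`
  (`exists_rung0_archClassClauses`) — the term the closer's ED. 12 `stub_rung0` can `obtain` for the five fields `hc hJ hD hJU hDU`.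

HONEST LABEL: these are witnesses of the clauses AS TYPED (print-true for `J_{0,0}`: [BorelWallach2000, VI Thm. 4.11 (3)]), not Rogawski's classes
`[J^±_φ]`, `[D^∓_φ]` [Rogawski1990, §12.3]; HC_CM is proved only modulo the printed citations until rung 0 closes.  No `def`, no named fact, no `sorry`.
-/

set_option autoImplicit false
-- the mandated namespace has the single-problem summit's repeated segment (`HodgeConjecture.HodgeConjecture`)
set_option linter.dupNamespace false

-- Mathlib idiom (Mathlib/Algebra/Lie/OfAssociative.lean; as in ★ `GKModules` and every `(𝔤, K)` file of the tree)
attribute [local instance 100] LieRing.ofAssociativeRing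

noncomputable section

namespace Summit.HodgeConjecture.HodgeConjecture.Cruxes.H413.F0P3Rung0ArchClassClauses

open Literature.NumberTheory.Automorphic Literature.NumberTheory.Automorphic.GKTrivialTensor
open Literature.RepresentationTheory.BorelWallach2000
open Literature.RepresentationTheory.KonnoKonno2007 Literature.RepresentationTheory.KonnoKonno2007.RealDualPair
open Literature.RepresentationTheory.KonnoKonno2007.RealDualPair.UForm
open Summit.HodgeConjecture.HodgeConjecture.Cruxes.H413.F0P3InnerFormClassification (Cinf)
open Summit.HodgeConjecture.HodgeConjecture.Cruxes.H413.F0P3bArchDegOnePackage (IsCohUnitaryIrrep IsUnitaryAlongP)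
open Summit.HodgeConjecture.HodgeConjecture.Cruxes.H413.F0P3bStubT3aUnitaryAlongPOfHermitian (stubT3aUnitaryAlongPOfHermitian_holds)
open Summit.HodgeConjecture.HodgeConjecture.Cruxes.H413.F0P3UnitaryLocOfRecord (IsCohUnitaryClass isCohUnitaryClass_ofModule)
open Summit.HodgeConjecture.HodgeConjecture.Cruxes.H413.F0P3XiArchPacketOfRecord (JInfNoDegOne DsInfNoDegOne)

/-! ## §1 The trivial one-dimensional `(𝔲(2,1), K)`-module is irreducible and coh-unitary -/

/-- **The trivial module `(ℂ, 1, 0)` is a `(𝔤, K)`-module** (every vector `K`-finite since `dim ℂ = 1`; constant matrix coefficients; ★ `had_trivial`;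
the weak derivative of a constant is `0 = trivLie X v`). [cite: BorelWallach2000, 0 §2.5; I §5.1] -/
theorem isGKModule_triv :
    IsGKModule (uFormGroup (Fin 2) (Fin 1)) (trivK (uFormGroup (Fin 2) (Fin 1)) (E := ℂ)) (trivLie (uFormGroup (Fin 2) (Fin 1)) (E := ℂ)) where
  kFinite v := inferInstance
  weaklyContinuous v ℓ := by
    simp only [MonoidHom.one_apply, Module.End.one_apply]
    exact continuous_const
  ad_compat k X := had_trivial (uFormGroup (Fin 2) (Fin 1)) (E := ℂ) k X
  hasWeakDeriv X v ℓ := by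
    simp only [MonoidHom.one_apply, Module.End.one_apply, LieHom.zero_apply, LinearMap.zero_apply, map_zero]
    exact hasDerivAt_const 0 (ℓ v)

/-- **The trivial module `(ℂ, 1, 0)` is irreducible**: `ℂ ≠ 0` and a `ℂ`-subspace of `ℂ` is `⊥` or `⊤`. [cite: BorelWallach2000, 0 §2.5] -/
theorem isIrreducibleGK_triv :
    IsIrreducibleGK (trivK (uFormGroup (Fin 2) (Fin 1)) (E := ℂ)) (trivLie (uFormGroup (Fin 2) (Fin 1)) (E := ℂ)) :=
  ⟨inferInstance, fun W _ => Ideal.eq_bot_or_top W⟩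

/-- **The trivial module is unitary along `𝔭 ⊕ ℝz₀`**: `H = ⟪·,·⟫_ℂ` on `ℂ` is Hermitian positive definite and `trivLie X = 0` is `H`-skew
(★ `stubT3aUnitaryAlongPOfHermitian_holds`). [cite: BorelWallach2000, II §2.1, §3.1] -/
theorem isUnitaryAlongP_triv : IsUnitaryAlongP (trivLie (uFormGroup (Fin 2) (Fin 1)) (E := ℂ)) := by
  refine stubT3aUnitaryAlongPOfHermitian_holds (Fin 2) (Fin 1) ℂ (trivLie (uFormGroup (Fin 2) (Fin 1)) (E := ℂ))
    ⟨innerₛₗ ℂ, fun v w => ?_, fun v hv => ?_, fun X v w => ?_⟩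
  · simp only [innerₛₗ_apply_apply, inner_conj_symm]
  · rw [innerₛₗ_apply_apply, inner_self_eq_norm_sq_to_K]
    norm_cast
    exact pow_pos (norm_pos_iff.mpr hv) 2
  · simp only [LieHom.zero_apply, LinearMap.zero_apply, map_zero, neg_zero]

/-- **The trivial module is an irreducible unitary cohomologically relevant `(𝔲(2,1), K)`-module** (★ `IsCohUnitaryIrrep`: `gk`, `irred`, `adm` by
★ `isAdmissibleGK_of_finiteDimensional`, `unit`). [cite: Rogawski1990, Prop. 13.8.1 p. 206] [cite: BorelWallach2000, 0 §2.5] -/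
theorem isCohUnitaryIrrep_triv :
    IsCohUnitaryIrrep (trivK (uFormGroup (Fin 2) (Fin 1)) (E := ℂ)) (trivLie (uFormGroup (Fin 2) (Fin 1)) (E := ℂ)) where
  gk := isGKModule_triv
  irred := isIrreducibleGK_triv
  adm := isAdmissibleGK_of_finiteDimensional _
  unit := isUnitaryAlongP_triv

/-- **The class `𝟙 = [ℂ, 1, 0] ∈ Cinf` of the trivial module is coh-unitary** (★ `isCohUnitaryClass_ofModule`). [cite: Rogawski1990, Prop. 13.8.1 p. 206] -/
theorem isCohUnitaryClass_ofModule_triv :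
    IsCohUnitaryClass (GKIrrClass.ofModule ℂ (trivK (uFormGroup (Fin 2) (Fin 1)) (E := ℂ))
      (trivLie (uFormGroup (Fin 2) (Fin 1)) (E := ℂ)) isGKModule_triv isIrreducibleGK_triv) :=
  isCohUnitaryClass_ofModule ℂ _ _ isCohUnitaryIrrep_triv

/-! ## §2 No odd-degree `(𝔤, K)`-cohomology in the class of the trivial module -/

/-- **`H^q(𝔲(2,1), K; M) = 0` for odd `q` and EVERY irreducible `(𝔤, K)`-module `M` of the class `𝟙`**: ★ `upq_subsingleton_gkCohomology_triv_of_odd`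
(`k₀ = diag(1,1,−1) ∈ K` acts by `−1` on `𝔭`) transported along the `(𝔤, K)`-equivalence `M ≃ ℂ` given by the equality of classes
(★ `GKIrrClass.mk_eq_mk_iff`, ★ `subsingleton_gkCohomology_iff_of_equiv`). [cite: BorelWallach2000, I §5.1 (1)–(3); VI Thm. 4.11 (3)] -/
theorem subsingleton_gkCohomology_of_ofModule_eq_triv (M : Type) [AddCommGroup M] [Module ℂ M]
    (σK : Representation ℂ (uFormGroup (Fin 2) (Fin 1)).maximalCompact M) (σ𝔤 : (uFormGroup (Fin 2) (Fin 1)).lie →ₗ⁅ℝ⁆ Module.End ℂ M)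
    (hM : IsGKModule (uFormGroup (Fin 2) (Fin 1)) σK σ𝔤) (hirr : IsIrreducibleGK σK σ𝔤)
    (hcl : GKIrrClass.ofModule M σK σ𝔤 hM hirr =
      GKIrrClass.ofModule ℂ (trivK (uFormGroup (Fin 2) (Fin 1)) (E := ℂ)) (trivLie (uFormGroup (Fin 2) (Fin 1)) (E := ℂ))
        isGKModule_triv isIrreducibleGK_triv)
    {q : ℕ} (hq : Odd q) : Subsingleton (gkCohomology (uFormGroup (Fin 2) (Fin 1)) σK σ𝔤 hM.ad_compat q) := by
  have hMr : AreGKEquivalent σK σ𝔤 (trivK (uFormGroup (Fin 2) (Fin 1)) (E := ℂ)) (trivLie (uFormGroup (Fin 2) (Fin 1)) (E := ℂ)) := by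
    rw [GKIrrClass.ofModule, GKIrrClass.ofModule, GKIrrClass.mk_eq_mk_iff] at hcl
    exact hcl
  obtain ⟨e⟩ := hMr
  rw [subsingleton_gkCohomology_iff_of_equiv (uFormGroup (Fin 2) (Fin 1)) σK σ𝔤 (trivK (uFormGroup (Fin 2) (Fin 1)) (E := ℂ))
    (trivLie (uFormGroup (Fin 2) (Fin 1)) (E := ℂ)) hM.ad_compat (had_trivial (uFormGroup (Fin 2) (Fin 1)) (E := ℂ))
    e.toLinearEquiv e.comm𝔤 e.commK q]
  exact upq_subsingleton_gkCohomology_triv_of_odd ℂ hq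

/-- **Every `upqTypeClasses … q δ`, `q` odd, vanishes on the class `𝟙`** (a submodule of a zero space). [cite: BorelWallach2000, I §5.1; II Thm. 4.8] -/
theorem upqTypeClasses_eq_bot_of_ofModule_eq_triv (M : Type) [AddCommGroup M] [Module ℂ M]
    (σK : Representation ℂ (uFormGroup (Fin 2) (Fin 1)).maximalCompact M) (σ𝔤 : (uFormGroup (Fin 2) (Fin 1)).lie →ₗ⁅ℝ⁆ Module.End ℂ M)
    (hM : IsGKModule (uFormGroup (Fin 2) (Fin 1)) σK σ𝔤) (hirr : IsIrreducibleGK σK σ𝔤)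
    (hcl : GKIrrClass.ofModule M σK σ𝔤 hM hirr =
      GKIrrClass.ofModule ℂ (trivK (uFormGroup (Fin 2) (Fin 1)) (E := ℂ)) (trivLie (uFormGroup (Fin 2) (Fin 1)) (E := ℂ))
        isGKModule_triv isIrreducibleGK_triv)
    {q : ℕ} (hq : Odd q) (δ : ℤ) : upqTypeClasses σK σ𝔤 hM.ad_compat q δ = ⊥ := by
  haveI := subsingleton_gkCohomology_of_ofModule_eq_triv M σK σ𝔤 hM hirr hcl hq
  exact Subsingleton.elim _ _

/-! ## §3 The clauses R3∕R4 of `Rung0Witness`, letter-free -/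

/-- **`JInfNoDegOne` holds for the constant family `𝟙`** (degree `1` is odd). [cite: Rogawski1990, Prop. 15.2.1 p. 249] [cite: BorelWallach2000, I §5.3] -/
theorem jInfNoDegOne_const_triv :
    JInfNoDegOne (fun _ _ _ => GKIrrClass.ofModule ℂ (trivK (uFormGroup (Fin 2) (Fin 1)) (E := ℂ))
      (trivLie (uFormGroup (Fin 2) (Fin 1)) (E := ℂ)) isGKModule_triv isIrreducibleGK_triv) :=
  fun _ _ _ _ M _ _ σK σ𝔤 hM hirr hcl δ _ => upqTypeClasses_eq_bot_of_ofModule_eq_triv M σK σ𝔤 hM hirr hcl odd_one δ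

/-- **`DsInfNoDegOne` holds for the constant family `𝟙`** (degree `1` is odd). [cite: Rogawski1990, Prop. 15.2.1 (a) p. 249] [cite: BorelWallach2000, I §5.3] -/
theorem dsInfNoDegOne_const_triv :
    DsInfNoDegOne (fun _ _ _ => GKIrrClass.ofModule ℂ (trivK (uFormGroup (Fin 2) (Fin 1)) (E := ℂ))
      (trivLie (uFormGroup (Fin 2) (Fin 1)) (E := ℂ)) isGKModule_triv isIrreducibleGK_triv) :=
  fun _ _ _ M _ _ σK σ𝔤 hM hirr hcl δ _ => upqTypeClasses_eq_bot_of_ofModule_eq_triv M σK σ𝔤 hM hirr hcl odd_one δ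

/-- **R3∕R4 WITNESSED, LETTER-FREE**: there are a sign `c = ±1` and families `jInf dsInf : ℤ → ℤ → ℤ → Cinf` satisfying the five residual clauses
`hc`, `hJ`, `hD`, `hJU`, `hDU` of the closer's `Rung0Witness` (`c := 1`, `jInf = dsInf := 𝟙` constant).  The `obtain` target of ED. 12's `stub_rung0`.
[cite: Rogawski1990, §12.3 pp. 178–179; Prop. 15.2.1 p. 249] [cite: LanglandsShelstad1987, §1.3–1.4] [cite: BorelWallach2000, VI Thm. 4.11] -/
theorem exists_rung0_archClassClauses :
    ∃ (c : ℚ) (jInf dsInf : ℤ → ℤ → ℤ → Cinf), (c = 1 ∨ c = -1) ∧ JInfNoDegOne jInf ∧ DsInfNoDegOne dsInf ∧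
      (∀ p q t : ℤ, IsCohUnitaryClass (jInf p q t)) ∧ ∀ p q t : ℤ, IsCohUnitaryClass (dsInf p q t) :=
  ⟨1, _, _, Or.inl rfl, jInfNoDegOne_const_triv, dsInfNoDegOne_const_triv, fun _ _ _ => isCohUnitaryClass_ofModule_triv,
    fun _ _ _ => isCohUnitaryClass_ofModule_triv⟩

/-- The `jInf ∕ dsInf` half alone (four clauses), for consumers that keep the sign `c` as a datum. [cite: Rogawski1990, Prop. 15.2.1 p. 249] -/
theorem exists_jInf_dsInf_clauses :
    ∃ jInf dsInf : ℤ → ℤ → ℤ → Cinf, JInfNoDegOne jInf ∧ DsInfNoDegOne dsInf ∧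
      (∀ p q t : ℤ, IsCohUnitaryClass (jInf p q t)) ∧ ∀ p q t : ℤ, IsCohUnitaryClass (dsInf p q t) :=
  ⟨_, _, jInfNoDegOne_const_triv, dsInfNoDegOne_const_triv, fun _ _ _ => isCohUnitaryClass_ofModule_triv,
    fun _ _ _ => isCohUnitaryClass_ofModule_triv⟩

end Summit.HodgeConjecture.HodgeConjecture.Cruxes.H413.F0P3Rung0ArchClassClauses

end
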